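import Mathlib
import Summits.Langlands.Langlands.Theorems.SkinnerWilesDefectOneReducibleOrdinaryProModularConnectednessFromPunctured
import Summits.Langlands.Langlands.Theorems.SkinnerWilesDefectOneReducibleOrdinaryProModularHullHypersurfacePunctured
import Summits.Langlands.Langlands.Theorems.SkinnerWilesDefectOneReducibleOrdinaryProModularHullPuncturedLocal
import Summits.Langlands.Langlands.Theorems.SkinnerWilesDefectOneReducibleOrdinaryProModularCechDepthTorsion
import Summits.Langlands.Langlands.Theorems.SkinnerWilesDefectOneReducibleOrdinaryProModularAlgebraicLefschetz

/-!
# Hypersurfaces in the reflexive hull are connected in codimension one (step (M1) of SGA 2 XIII 2.1)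

Route `SkinnerWilesDefectOne`, crux `ReducibleOrdinaryProModular` (stmt-Langlands-12919), line
`fine-selmer-codimension-two`, stub (R) `stub_raynaudConnectedness` = Grothendieck's connectedness theorem
[SGA 2 XIII 2.1]; this is step (M1) of the lead's (c3) proof, the "m = 1" case for the reflexive hull `D`
of a complete local domain over its Cohen subring `S` (regular local of dimension `d ≥ 3`): **for every
`0 ≠ f ∈ 𝔪_D`, `V(f) ⊆ Spec D` is connected in dimension `d − 2`** (every two-colouring of the minimal
primes of `D/(f)` using both colours has a cross pair `C₁, C₂` with `d − 2 ≤ dim (D/(f))/(C₁ + C₂)`).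
Assembly of three landed pieces: the Hartshorne-type combinatorics `(H3)` (`…ConnectednessFromPunctured`:
connectedness in dimension `n` from punctured connectedness at the closed point and at all primes of
coheight `≤ n − 1`), the punctured connectedness of `V(f)` at `𝔪` (`(M1a)`, `…HullHypersurfacePunctured`)
and at the localisations `D_𝔭` (`(M1b)`, `…HullPuncturedLocal`) — both instances of the algebraic local
Lefschetz theorem (`…AlgebraicLefschetz`) fed by the depth/torsion lemma for second syzygies
(`…CechDepthTorsion`).

* `FineSelmerCodimensionTwo.stub_raynaudConnectedness_auxHypersurfaceHull` — the registered sub-goal (M1).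

References: A. Grothendieck, SGA 2, Exp. XIII §2 [Grothendieck1968SGA2]; R. Hartshorne, Amer. J. Math. 84
(1962) [Hartshorne1962].
-/

set_option linter.dupNamespace false -- project-wide option (lakefile weak.linter.dupNamespace); `Summit.Langlands.Langlands` is the mandated namespace
set_option autoImplicit false

noncomputable section

namespace Summit.Langlands.Langlands.Cruxes.ReducibleOrdinaryProModular.FineSelmerCodimensionTwo

open IsLocalRing

set_option linter.overlappingInstances false in
/-- **Registered sub-goal `stub_raynaudConnectedness_auxHypersurfaceHull` of stub (R) `stub_raynaudConnectedness`**
(c3, SGA 2 XIII 2.1 programme, step (M1)): in the reflexive hull `D ⊇ S` (`S` regular local of dimension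
`d ≥ 3`, `D` a second syzygy over `S`), every hypersurface `V(f)`, `0 ≠ f ∈ 𝔪_D`, is connected in dimension
`d − 2`.  Proof: `(H3)` with the punctured statements `(M1a)` at `𝔪` and `(M1b)` at the primes of coheight
`≤ d − 3`, the hypotheses `(H1b)`, `(G5)` of those being the landed `stub_raynaudConnectedness_auxDepthTorsion`
and `stub_raynaudConnectedness_auxLefschetz`. [cite: Grothendieck1968SGA2, Exp. XIII §2] -/
theorem stub_raynaudConnectedness_auxHypersurfaceHull :
    ∀ (S : Type) [CommRing S] [IsRegularLocalRing S] (D : Type) [CommRing D] [IsDomain D] [IsNoetherianRing D] [IsLocalRing D] [Algebra S D] [Module.Finite S D], Function.Injective (algebraMap S D) → (IsLocalRing.maximalIdeal S).map (algebraMap S D) ≤ IsLocalRing.maximalIdeal D → IsLocalRing.maximalIdeal D ≤ ((IsLocalRing.maximalIdeal S).map (algebraMap S D)).radical → ∀ (a b : ℕ) (Φ : D →ₗ[S] (Fin a → S)) (Ψ : (Fin a → S) →ₗ[S] (Fin b → S)), Function.Injective Φ → LinearMap.range Φ = LinearMap.ker Ψ → ∀ (d : ℕ), (d : WithBot ℕ∞)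 = ringKrullDim S → 3 ≤ d → ∀ f : D, f ≠ 0 → f ∈ IsLocalRing.maximalIdeal D → ∀ T : Set (PrimeSpectrum (D ⧸ Ideal.span {f})), (∃ C ∈ T, C.asIdeal ∈ minimalPrimes (D ⧸ Ideal.span {f})) → (∃ C ∉ T, C.asIdeal ∈ minimalPrimes (D ⧸ Ideal.span {f})) → ∃ C₁ ∈ T, ∃ C₂ ∉ T, C₁.asIdeal ∈ minimalPrimes (D ⧸ Ideal.span {f}) ∧ C₂.asIdeal ∈ minimalPrimes (D ⧸ Ideal.span {f}) ∧ ((d - 2 : ℕ) : WithBot ℕ∞) ≤ ringKrullDim ((D ⧸ Ideal.span {f}) ⧸ (C₁.asIdeal ⊔ C₂.asIdeal)) := by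
  intro S _ _ D _ _ _ _ _ _ hinj hmS hradS a b Φ Ψ hΦ hex d hd h3 f hf0 hfm
  classical
  -- `R = D/(f)` is a Noetherian local ring
  have hIle : Ideal.span ({f} : Set D) ≤ maximalIdeal D := by
    rw [Ideal.span_singleton_le_iff_mem]; exact hfm
  haveI : Nontrivial (D ⧸ Ideal.span ({f} : Set D)) := Ideal.Quotient.nontrivial_iff.mpr
    (ne_top_of_le_ne_top (Ideal.IsMaximal.ne_top inferInstance) hIle)
  haveI : IsLocalRing (D ⧸ Ideal.span ({f} : Set D)) :=
    IsLocalRing.of_surjective' (Ideal.Quotient.mk _) Ideal.Quotient.mk_surjective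
  refine stub_raynaudConnectedness_auxCodimOneOfPunctured (D ⧸ Ideal.span {f}) (d - 2) ?_ ?_
  · -- punctured connectedness at the closed point: (M1a)
    exact stub_raynaudConnectedness_auxHullPunctured stub_raynaudConnectedness_auxDepthTorsion S D hinj hmS
      hradS a b Φ Ψ hΦ hex d hd h3 f hf0 hfm
  · -- punctured connectedness at the primes of coheight `≤ d - 3`: (M1b)
    intro p hp hdim
    refine stub_raynaudConnectedness_auxHullPuncturedLocal stub_raynaudConnectedness_auxDepthTorsion
      stub_raynaudConnectedness_auxLefschetz S D hinj hmS hradS a b Φ Ψ hΦ hex d hd h3 f hf0 hfm p ?_ hdim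
    -- `p ≠ 𝔪_R` ⟹ its contraction is not `𝔪_D`
    intro hcomap
    apply hp
    have hsurj : Function.Surjective (Ideal.Quotient.mk (Ideal.span ({f} : Set D))) :=
      Ideal.Quotient.mk_surjective
    calc p.asIdeal = (p.asIdeal.comap (Ideal.Quotient.mk (Ideal.span {f}))).map
          (Ideal.Quotient.mk (Ideal.span {f})) := (Ideal.map_comap_of_surjective _ hsurj _).symm
      _ = (maximalIdeal D).map (Ideal.Quotient.mk (Ideal.span {f})) := by rw [hcomap]
      _ = maximalIdeal (D ⧸ Ideal.span {f}) := IsLocalRing.map_maximalIdeal_of_surjective _ hsurj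

end Summit.Langlands.Langlands.Cruxes.ReducibleOrdinaryProModular.FineSelmerCodimensionTwo

end
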